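import Literature.MathematicalPhysics.QuantumLattice.SectorPartitionFnCut
import Literature.MathematicalPhysics.QuantumLattice.TorusSectorPressureTypeBoundAllTori
import Literature.MathematicalPhysics.QuantumLattice.SpinSectorPartitionFnRelabel
import HarnessLib

/-!
# Canonical partition functions of the `t–t'` torus: cutting a torus into TORI (with seam penalties),
# strips, squares, and filling the complement of a corner torus — at positive temperature

Topic `MathematicalPhysics/QuantumLattice` (family `hubbard`). The positive-temperature twin of
`HubbardNNNHoppingTiling.lean` (which proves the same three shapes for the sector GROUND-STATE energies
`E_{a×b}(N)` of `hubbardRectTorusTT'`, feeding Fekete's lemma along squares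
`SquareTilingLimit.tendsto_of_tiling_of_filling` and hence the `T = 0` thermodynamic limit
`tendsto_energyDensityTT'`). Here the object is the canonical (spin-sector) partition function
`Z_β(a×b; p, q) := Re Z_β(spinSectorHamiltonian p q (hubbardRectTorusTT' a b t t' U))`, `β ≥ 0`, and every
additive defect `+ D` of the zero-temperature file becomes a multiplicative factor `e^{−βD}`:

* `partitionFn_hubbardRectTorusTT'_cut` — THE MAJOR CUT OF A TORUS INTO TWO TORI:
  `e^{−β(8|t| + 16|t'|) b} · Z(a₁×b; p₁,q₁) · Z(a₂×b; p₂,q₂) ≤ Z((a₁+a₂)×b; p₁+p₂, q₁+q₂)` — the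
  finite-temperature cut `ThermodynamicLimit.partitionFn_twoGraph_sector_cut` (Peierls for graded tensor
  products of the two sector eigenbases) with the wrap-around discrepancy counts of the zero-temperature cut
  (`card_discrepancy_rectCastAdd/_rectNatAdd` `≤ 2b`, `card_discrepancy_diag_*` `≤ 4b`);
* `partitionFn_spinSector_hubbardRectTorusTT'_swap` — `Z(b×a; p,q) = Z(a×b; p,q)` (coordinate swap);
* `prod_partitionFn_hubbardRectTorusTT'_strips_le` — STRIPS: for any block sectors `(p_i, q_i)`,
  `e^{−β(8|t|+16|t'|) b k} Π_{i ≤ k} Z(M×b; p_i,q_i) ≤ Z((k+1)M × b; Σp_i, Σq_i)`;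
* `prod_partitionFn_hubbardRectTorusTT'_squares_le` — SQUARES:
  `e^{−β(16|t|+32|t'|) M k (k+1)} Π_{i,j ≤ k} Z(M×M; p_ij,q_ij) ≤ Z((k+1)M × (k+1)M; Σp_ij, Σq_ij)`;
* `partitionFn_hubbardRectTorusTT'_square_fill` — FILLING the complement of the corner torus `ℓ × ℓ` in
  `(ℓ+r) × (ℓ+r)` with `q` extra electron PAIRS parked in the two complementary rectangular tori at the crude
  cost `e^{−β U⁺ q}` (`exp_neg_le_partitionFn_spinSector_twoGraph`):
  `e^{−β((8|t|+16|t'|)(2ℓ+r) + U⁺ q)} · Z(ℓ×ℓ; p,p) ≤ Z((ℓ+r)×(ℓ+r); p+q, p+q)` for `q ≤ rℓ + r(ℓ+r)`.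

These are the tiling / filling inputs of the thermodynamic limit of the canonical pressure
(`HubbardTTPrimeThermalPressureLimit.lean`); the density-rounding input is
`CanonicalPartitionFnAdjacentSectors.lean`. Everything is PROVED; no definition, no named fact.

## Mathlib / tree search

REUSED: `ThermodynamicLimit.partitionFn_twoGraph_sector_cut` (`SectorPartitionFnCut`), `strictMono_rectCastAdd`,
`strictMono_rectNatAdd`, `rectCastAdd_lt_rectNatAdd`, `rectCastAdd_cover`, `card_discrepancy_rectCastAdd`,
`card_discrepancy_rectNatAdd`, `fermionRectTorusGraph_adj_rectSwap`, `card_rectSites` (`HubbardRectangularTorus`),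
`card_discrepancy_diag_rectCastAdd`, `card_discrepancy_diag_rectNatAdd` (`HubbardNNNHoppingCut`),
`partitionFn_spinSector_hamiltonian₂_eq_of_iso` (`SpinSectorPartitionFnRelabel`), `partitionFn_spinSector_re_nonneg`
(`TorusSectorPartitionFnTiling`), `exp_neg_le_partitionFn_spinSector_twoGraph` (`TorusSectorPressureTypeBoundAllTori`).
`lean search 'hubbardRectTorusTT.*cut|strips_le|squares_le'`: only the open-box (induced, penalty-free) tilings
`prod_partitionFn_openBox_le_rectTorus` and the `T = 0` versions (2026-08-27).

## References

* D. Ruelle, *Statistical Mechanics: Rigorous Results* (1969), §2.2, §3.3 Prop. 3.3.2–3.3.3 (sub-boxes with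
  corridor/seam terms), §2.5 (Peierls). [cite: Ruelle1969, §3.3]
* R. B. Israel, *Convexity in the Theory of Lattice Gases* (1979), Lemma II.3.1. [cite: Israel1979, Lemma II.3.1]
* J. P. F. LeBlanc et al., Phys. Rev. X 5 (2015) 041041, eq. (1). [cite: LeBlancEtAl2015, eq. (1)]
-/

noncomputable section

namespace Literature.MathematicalPhysics.QuantumLattice

open Matrix Finset HubbardWave0 ThermodynamicLimit LiebThm1
open scoped ComplexOrder BigOperators

namespace ThermodynamicLimit

/-! ### §1 The major cut of a torus into two tori; the coordinate swap -/

/-- Nonnegativity of the torus canonical partition functions. [cite: Israel1979, Lemma II.3.1] -/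
theorem partitionFn_spinSector_hubbardRectTorusTT'_re_nonneg (a b : ℕ) (t t' U β : ℝ) (p q : ℕ) :
    0 ≤ (partitionFn β (spinSectorHamiltonian p q (hubbardRectTorusTT' a b t t' U))).re :=
  partitionFn_spinSector_re_nonneg p q (hubbardRectTorusTT'_isHermitian a b t t' U) β

/-- **The major cut of the `t–t'` torus at positive temperature.** Cutting `ℤ/(a₁+a₂)ℤ × ℤ/bℤ` into the
tori `ℤ/a₁ℤ × ℤ/bℤ` and `ℤ/a₂ℤ × ℤ/bℤ` costs the factor `e^{−β(8|t| + 16|t'|) b}` (nearest-neighbour seam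
`≤ 2b + 2b` ordered pairs at `2|t|` each, diagonal seam `≤ 4b + 4b` at `2|t'|` each): for `β ≥ 0` and all block
sectors, `e^{−β(8|t|b + 16|t'|b)} · Z(a₁×b; p₁,q₁) · Z(a₂×b; p₂,q₂) ≤ Z((a₁+a₂)×b; p₁+p₂, q₁+q₂)`.
[cite: Ruelle1969, §3.3] [cite: Israel1979, Lemma II.3.1] -/
theorem partitionFn_hubbardRectTorusTT'_cut (a₁ a₂ b : ℕ) (t t' U : ℝ) {β : ℝ} (hβ : 0 ≤ β)
    (p₁ q₁ p₂ q₂ : ℕ) :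
    Real.exp (-(β * ((8 * |t| + 16 * |t'|) * b))) *
        (partitionFn β (spinSectorHamiltonian p₁ q₁ (hubbardRectTorusTT' a₁ b t t' U))).re *
        (partitionFn β (spinSectorHamiltonian p₂ q₂ (hubbardRectTorusTT' a₂ b t t' U))).re ≤
      (partitionFn β (spinSectorHamiltonian (p₁ + p₂) (q₁ + q₂)
        (hubbardRectTorusTT' (a₁ + a₂) b t t' U))).re := by
  have h := partitionFn_twoGraph_sector_cut (fermionRectTorusGraph a₁ b)
    (fermionRectTorusDiagGraph a₁ b) (fermionRectTorusGraph a₂ b) (fermionRectTorusDiagGraph a₂ b)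
    (fermionRectTorusGraph (a₁ + a₂) b) (fermionRectTorusDiagGraph (a₁ + a₂) b)
    (strictMono_rectCastAdd a₁ a₂ b) (strictMono_rectNatAdd a₁ a₂ b)
    (rectCastAdd_lt_rectNatAdd a₁ a₂ b) (rectCastAdd_cover a₁ a₂ b)
    (card_discrepancy_rectCastAdd a₁ a₂ b) (card_discrepancy_rectNatAdd a₁ a₂ b)
    (card_discrepancy_diag_rectCastAdd a₁ a₂ b) (card_discrepancy_diag_rectNatAdd a₁ a₂ b)
    t U t' 0 hβ p₁ q₁ p₂ q₂
  unfold hubbardRectTorusTT'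
  refine le_trans (le_of_eq ?_) h
  congr 2
  push_cast
  ring

/-- The diagonal bond set is swap-symmetric (re-derived; private in `HubbardNNNHoppingCut`).
[cite: LeBlancEtAl2015, eq. (1)] -/
theorem fermionRectTorusDiagGraph_adj_rectSwap' {a b : ℕ} (p q : Fin a ×ₗ Fin b) :
    (fermionRectTorusDiagGraph b a).Adj (rectSwap a b p) (rectSwap a b q) ↔
      (fermionRectTorusDiagGraph a b).Adj p q := by
  rw [fermionRectTorusDiagGraph_adj_iff, fermionRectTorusDiagGraph_adj_iff]
  exact And.comm

/-- **Swap invariance of the torus canonical partition functions**: `Z(b×a; p,q) = Z(a×b; p,q)` (the coordinate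
swap is a graph isomorphism for both bond sets). [cite: BratteliRobinsonII1997, §5.2.2, Thm. 5.2.5] -/
theorem partitionFn_spinSector_hubbardRectTorusTT'_swap (a b : ℕ) (t t' U β : ℝ) (p q : ℕ) :
    partitionFn β (spinSectorHamiltonian p q (hubbardRectTorusTT' b a t t' U)) =
      partitionFn β (spinSectorHamiltonian p q (hubbardRectTorusTT' a b t t' U)) := by
  unfold hubbardRectTorusTT'
  exact partitionFn_spinSector_hamiltonian₂_eq_of_iso (f := rectSwap a b) (fermionRectTorusGraph a b)
    (fermionRectTorusDiagGraph a b) (fermionRectTorusGraph b a) (fermionRectTorusDiagGraph b a)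
    fermionRectTorusGraph_adj_rectSwap fermionRectTorusDiagGraph_adj_rectSwap' t U t' 0 β p q

/-! ### §2 Strips and squares -/

/-- **Strips at positive temperature.** Cutting `ℤ/(k+1)Mℤ × ℤ/bℤ` into `k+1` copies of `ℤ/Mℤ × ℤ/bℤ` with
arbitrary block sectors `(p_i, q_i)`: `e^{−β(8|t|+16|t'|) b k} Π_i Z(M×b; p_i,q_i) ≤ Z((k+1)M × b; Σp_i, Σq_i)`.
[cite: Ruelle1969, §3.3] -/
theorem prod_partitionFn_hubbardRectTorusTT'_strips_le (M b : ℕ) (t t' U : ℝ) {β : ℝ} (hβ : 0 ≤ β) :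
    ∀ (k : ℕ) (ps qs : Fin (k + 1) → ℕ),
      Real.exp (-(β * ((8 * |t| + 16 * |t'|) * b * k))) *
          ∏ i, (partitionFn β (spinSectorHamiltonian (ps i) (qs i) (hubbardRectTorusTT' M b t t' U))).re ≤
        (partitionFn β (spinSectorHamiltonian (∑ i, ps i) (∑ i, qs i)
          (hubbardRectTorusTT' ((k + 1) * M) b t t' U))).re := by
  intro k
  induction k with
  | zero =>
      intro ps qs
      rw [show (0 + 1) * M = M by ring, Fin.prod_univ_one, Fin.sum_univ_one, Fin.sum_univ_one]
      simp
  | succ k ih =>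
      intro ps qs
      have eP : ∏ i, (partitionFn β (spinSectorHamiltonian (ps i) (qs i) (hubbardRectTorusTT' M b t t' U))).re =
          (∏ i : Fin (k + 1), (partitionFn β (spinSectorHamiltonian (ps (Fin.castSucc i)) (qs (Fin.castSucc i))
            (hubbardRectTorusTT' M b t t' U))).re) *
            (partitionFn β (spinSectorHamiltonian (ps (Fin.last _)) (qs (Fin.last _))
              (hubbardRectTorusTT' M b t t' U))).re :=
        Fin.prod_univ_castSucc _
      have ep : ∑ i, ps i = ∑ i : Fin (k + 1), ps (Fin.castSucc i) + ps (Fin.last _) := Fin.sum_univ_castSucc _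
      have eq : ∑ i, qs i = ∑ i : Fin (k + 1), qs (Fin.castSucc i) + qs (Fin.last _) := Fin.sum_univ_castSucc _
      rw [show (k + 1 + 1) * M = (k + 1) * M + M by ring, eP, ep, eq]
      have hcut := partitionFn_hubbardRectTorusTT'_cut ((k + 1) * M) M b t t' U hβ
        (∑ i : Fin (k + 1), ps (Fin.castSucc i)) (∑ i : Fin (k + 1), qs (Fin.castSucc i))
        (ps (Fin.last _)) (qs (Fin.last _))
      have hih := ih (fun i => ps (Fin.castSucc i)) (fun i => qs (Fin.castSucc i))
      set e₁ := Real.exp (-(β * ((8 * |t| + 16 * |t'|) * b))) with he₁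
      set eK := Real.exp (-(β * ((8 * |t| + 16 * |t'|) * b * k))) with heK
      have hsplit : Real.exp (-(β * ((8 * |t| + 16 * |t'|) * b * ((k + 1 : ℕ) : ℝ)))) = e₁ * eK := by
        rw [he₁, heK, ← Real.exp_add]
        congr 1
        push_cast
        ring
      have hZ₂ := partitionFn_spinSector_hubbardRectTorusTT'_re_nonneg M b t t' U β (ps (Fin.last _)) (qs (Fin.last _))
      rw [hsplit]
      calc e₁ * eK * ((∏ i : Fin (k + 1), (partitionFn β (spinSectorHamiltonian (ps (Fin.castSucc i))
              (qs (Fin.castSucc i)) (hubbardRectTorusTT' M b t t' U))).re) *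
            (partitionFn β (spinSectorHamiltonian (ps (Fin.last _)) (qs (Fin.last _))
              (hubbardRectTorusTT' M b t t' U))).re)
          = e₁ * (eK * ∏ i : Fin (k + 1), (partitionFn β (spinSectorHamiltonian (ps (Fin.castSucc i))
              (qs (Fin.castSucc i)) (hubbardRectTorusTT' M b t t' U))).re) *
            (partitionFn β (spinSectorHamiltonian (ps (Fin.last _)) (qs (Fin.last _))
              (hubbardRectTorusTT' M b t t' U))).re := by ring
        _ ≤ e₁ * (partitionFn β (spinSectorHamiltonian (∑ i : Fin (k + 1), ps (Fin.castSucc i))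
              (∑ i : Fin (k + 1), qs (Fin.castSucc i)) (hubbardRectTorusTT' ((k + 1) * M) b t t' U))).re *
            (partitionFn β (spinSectorHamiltonian (ps (Fin.last _)) (qs (Fin.last _))
              (hubbardRectTorusTT' M b t t' U))).re := by
            gcongr
        _ ≤ _ := hcut

/-- **Squares at positive temperature.** Tiling `ℤ/(k+1)Mℤ × ℤ/(k+1)Mℤ` by `(k+1)²` copies of
`ℤ/Mℤ × ℤ/Mℤ` with arbitrary block sectors `(p_ij, q_ij)`:
`e^{−β(16|t|+32|t'|) M k (k+1)} Π_{i,j} Z(M×M; p_ij,q_ij) ≤ Z((k+1)M × (k+1)M; Σp_ij, Σq_ij)` (strips in the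
major direction, the coordinate swap, strips again). [cite: Ruelle1969, §3.3] -/
theorem prod_partitionFn_hubbardRectTorusTT'_squares_le (M : ℕ) (t t' U : ℝ) {β : ℝ} (hβ : 0 ≤ β) (k : ℕ)
    (ps qs : Fin (k + 1) → Fin (k + 1) → ℕ) :
    Real.exp (-(β * ((16 * |t| + 32 * |t'|) * M * k * (k + 1)))) *
        ∏ i, ∏ j, (partitionFn β (spinSectorHamiltonian (ps i j) (qs i j) (hubbardRectTorusTT' M M t t' U))).re ≤
      (partitionFn β (spinSectorHamiltonian (∑ i, ∑ j, ps i j) (∑ i, ∑ j, qs i j)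
        (hubbardRectTorusTT' ((k + 1) * M) ((k + 1) * M) t t' U))).re := by
  set c : ℝ := 8 * |t| + 16 * |t'| with hc
  -- strips in the major direction, blocks `M × (k+1)M` with the row sums
  have h1 := prod_partitionFn_hubbardRectTorusTT'_strips_le M ((k + 1) * M) t t' U hβ k
    (fun i => ∑ j, ps i j) (fun i => ∑ j, qs i j)
  -- each block: swap, then strips again
  have h2 : ∀ i, Real.exp (-(β * (c * M * k))) *
      ∏ j, (partitionFn β (spinSectorHamiltonian (ps i j) (qs i j) (hubbardRectTorusTT' M M t t' U))).re ≤
      (partitionFn β (spinSectorHamiltonian (∑ j, ps i j) (∑ j, qs i j)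
        (hubbardRectTorusTT' M ((k + 1) * M) t t' U))).re := by
    intro i
    rw [← partitionFn_spinSector_hubbardRectTorusTT'_swap]
    exact prod_partitionFn_hubbardRectTorusTT'_strips_le M M t t' U hβ k (ps i) (qs i)
  have hE0 : 0 ≤ Real.exp (-(β * (c * M * k))) := (Real.exp_pos _).le
  have h3 : ∏ i, (Real.exp (-(β * (c * M * k))) *
      ∏ j, (partitionFn β (spinSectorHamiltonian (ps i j) (qs i j) (hubbardRectTorusTT' M M t t' U))).re) ≤
      ∏ i, (partitionFn β (spinSectorHamiltonian (∑ j, ps i j) (∑ j, qs i j)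
        (hubbardRectTorusTT' M ((k + 1) * M) t t' U))).re :=
    Finset.prod_le_prod (fun i _ => mul_nonneg hE0 (Finset.prod_nonneg fun j _ =>
      partitionFn_spinSector_hubbardRectTorusTT'_re_nonneg M M t t' U β _ _)) fun i _ => h2 i
  rw [Finset.prod_mul_distrib, Finset.prod_const, Finset.card_univ, Fintype.card_fin] at h3
  -- assemble the two exponentials
  have hexp : Real.exp (-(β * ((16 * |t| + 32 * |t'|) * M * k * (k + 1)))) =
      Real.exp (-(β * (c * ((k + 1) * M : ℕ) * k))) * Real.exp (-(β * (c * M * k))) ^ (k + 1) := by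
    rw [← Real.exp_nat_mul, ← Real.exp_add]
    congr 1
    rw [hc]
    push_cast
    ring
  rw [hexp, mul_assoc]
  have hE1 : 0 ≤ Real.exp (-(β * (c * ((k + 1) * M : ℕ) * k))) := (Real.exp_pos _).le
  calc Real.exp (-(β * (c * ((k + 1) * M : ℕ) * k))) * (Real.exp (-(β * (c * M * k))) ^ (k + 1) *
        ∏ i, ∏ j, (partitionFn β (spinSectorHamiltonian (ps i j) (qs i j) (hubbardRectTorusTT' M M t t' U))).re)
      ≤ Real.exp (-(β * (c * ((k + 1) * M : ℕ) * k))) *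
        ∏ i, (partitionFn β (spinSectorHamiltonian (∑ j, ps i j) (∑ j, qs i j)
          (hubbardRectTorusTT' M ((k + 1) * M) t t' U))).re := mul_le_mul_of_nonneg_left h3 hE1
    _ ≤ _ := by
        have h1' := h1
        rw [hc]
        push_cast at h1' ⊢
        exact h1'

/-! ### §3 Filling the complement of a corner torus -/

/-- **Crude floor for a rectangular torus**: `e^{−β U⁺ q} ≤ Z(a×b; q, q)` for `q ≤ ab` (one occupation-basis
vector with `q` doubly occupied sites at most; Peierls for one vector). [cite: Ruelle1969, §3.3] -/
theorem exp_neg_le_partitionFn_spinSector_hubbardRectTorusTT' (a b : ℕ) (t t' U : ℝ) {β : ℝ} (hβ : 0 ≤ β)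
    {q : ℕ} (hq : q ≤ a * b) :
    Real.exp (-(β * max U 0 * q)) ≤
      (partitionFn β (spinSectorHamiltonian q q (hubbardRectTorusTT' a b t t' U))).re := by
  have hq' : q ≤ Fintype.card (Fin a ×ₗ Fin b) := by rw [card_rectSites]; exact hq
  have h := exp_neg_le_partitionFn_spinSector_twoGraph (fermionRectTorusGraph a b) (fermionRectTorusDiagGraph a b)
    t U t' 0 hβ hq' hq'
  rw [add_zero, min_self] at h
  unfold hubbardRectTorusTT'
  exact h

/-- **Monotonicity up to the complement, at positive temperature.** A trial of the big `t–t'` torus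
`ℤ/(ℓ+r)ℤ × ℤ/(ℓ+r)ℤ` made of the corner torus `ℓ × ℓ` in the sector `(p, p)` and the two complementary
rectangular tori `r × ℓ`, `r × (ℓ+r)` carrying `q ≤ rℓ + r(ℓ+r)` electron pairs at the crude cost:
`e^{−β((8|t|+16|t'|)(2ℓ+r) + U⁺ q)} · Z(ℓ×ℓ; p,p) ≤ Z((ℓ+r)×(ℓ+r); p+q, p+q)`. [cite: Ruelle1969, §3.3] -/
theorem partitionFn_hubbardRectTorusTT'_square_fill (ℓ r : ℕ) (t t' U : ℝ) {β : ℝ} (hβ : 0 ≤ β) (p : ℕ)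
    {q : ℕ} (hq : q ≤ r * ℓ + r * (ℓ + r)) :
    Real.exp (-(β * ((8 * |t| + 16 * |t'|) * (2 * ℓ + r) + max U 0 * q))) *
        (partitionFn β (spinSectorHamiltonian p p (hubbardRectTorusTT' ℓ ℓ t t' U))).re ≤
      (partitionFn β (spinSectorHamiltonian (p + q) (p + q)
        (hubbardRectTorusTT' (ℓ + r) (ℓ + r) t t' U))).re := by
  -- split the extra pairs between the two rectangles
  set q₁ : ℕ := min q (r * ℓ) with hq₁
  set q₂ : ℕ := q - q₁ with hq₂
  have hq₁le : q₁ ≤ r * ℓ := min_le_right _ _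
  have hq₁le' : q₁ ≤ q := min_le_left _ _
  have hqsplit : q = q₁ + q₂ := by omega
  have hq₂le : q₂ ≤ r * (ℓ + r) := by
    rcases le_total q (r * ℓ) with h | h
    · have : q₁ = q := min_eq_left h
      omega
    · have : q₁ = r * ℓ := min_eq_right h
      omega
  -- big cut along the major direction: blocks `ℓ × (ℓ+r)` and `r × (ℓ+r)`
  have hcut1 := partitionFn_hubbardRectTorusTT'_cut ℓ r (ℓ + r) t t' U hβ (p + q₁) (p + q₁) q₂ q₂
  -- the first block: swap, and cut again into `ℓ × ℓ` and `r × ℓ`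
  have hswap := congrArg Complex.re
    (partitionFn_spinSector_hubbardRectTorusTT'_swap (ℓ + r) ℓ t t' U β (p + q₁) (p + q₁))
  have hcut2 := partitionFn_hubbardRectTorusTT'_cut ℓ r ℓ t t' U hβ p p q₁ q₁
  -- crude floors on the two rectangles
  have hB1 := exp_neg_le_partitionFn_spinSector_hubbardRectTorusTT' r ℓ t t' U hβ hq₁le
  have hB2 := exp_neg_le_partitionFn_spinSector_hubbardRectTorusTT' r (ℓ + r) t t' U hβ hq₂le
  have hZsq0 := partitionFn_spinSector_hubbardRectTorusTT'_re_nonneg ℓ ℓ t t' U β p p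
  have hZmid0 := partitionFn_spinSector_hubbardRectTorusTT'_re_nonneg ℓ (ℓ + r) t t' U β (p + q₁) (p + q₁)
  have e0 : 0 ≤ Real.exp (-(β * ((8 * |t| + 16 * |t'|) * ((ℓ + r : ℕ) : ℝ)))) := (Real.exp_pos _).le
  have e1 : 0 ≤ Real.exp (-(β * ((8 * |t| + 16 * |t'|) * (ℓ : ℝ)))) := (Real.exp_pos _).le
  -- step 1: the corner torus and the small rectangle inside the first block
  have hstep1 : Real.exp (-(β * ((8 * |t| + 16 * |t'|) * (ℓ : ℝ)))) *
      (partitionFn β (spinSectorHamiltonian p p (hubbardRectTorusTT' ℓ ℓ t t' U))).re *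
      Real.exp (-(β * max U 0 * q₁)) ≤
      (partitionFn β (spinSectorHamiltonian (p + q₁) (p + q₁) (hubbardRectTorusTT' ℓ (ℓ + r) t t' U))).re := by
    rw [hswap]
    exact le_trans (mul_le_mul_of_nonneg_left hB1 (mul_nonneg e1 hZsq0)) hcut2
  -- step 2: the first block and the big rectangle inside the big torus
  have hstep2 : Real.exp (-(β * ((8 * |t| + 16 * |t'|) * ((ℓ + r : ℕ) : ℝ)))) *
      (Real.exp (-(β * ((8 * |t| + 16 * |t'|) * (ℓ : ℝ)))) *
        (partitionFn β (spinSectorHamiltonian p p (hubbardRectTorusTT' ℓ ℓ t t' U))).re *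
        Real.exp (-(β * max U 0 * q₁))) *
      Real.exp (-(β * max U 0 * q₂)) ≤
      (partitionFn β (spinSectorHamiltonian (p + q₁ + q₂) (p + q₁ + q₂)
        (hubbardRectTorusTT' (ℓ + r) (ℓ + r) t t' U))).re := by
    refine le_trans ?_ hcut1
    exact mul_le_mul (mul_le_mul_of_nonneg_left hstep1 e0) hB2 (Real.exp_pos _).le (mul_nonneg e0 hZmid0)
  -- the total exponential splits into the four factors
  have hexp : Real.exp (-(β * ((8 * |t| + 16 * |t'|) * (2 * ℓ + r) + max U 0 * q))) =
      Real.exp (-(β * ((8 * |t| + 16 * |t'|) * ((ℓ + r : ℕ) : ℝ)))) *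
        Real.exp (-(β * ((8 * |t| + 16 * |t'|) * (ℓ : ℝ)))) *
        Real.exp (-(β * max U 0 * q₁)) * Real.exp (-(β * max U 0 * q₂)) := by
    rw [← Real.exp_add, ← Real.exp_add, ← Real.exp_add]
    congr 1
    rw [hqsplit]
    push_cast
    ring
  rw [hexp, show p + q = p + q₁ + q₂ by omega]
  refine le_trans (le_of_eq ?_) hstep2
  ring

end ThermodynamicLimit

end Literature.MathematicalPhysics.QuantumLattice
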